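import Mathlib
import HarnessLib
import Summits.Langlands.Langlands.Theorems.ExteriorSquareAscentSelfTwistedIrreducibleStubPinnedDoublingKillAux
import Literature.NumberTheory.Automorphic.PairLFunctionConjHolomorphy
import Literature.NumberTheory.Automorphic.PairLFunctionPolesEqConjLeTwo
import Literature.NumberTheory.Automorphic.SatakeParameterBoundHolds
import Literature.NumberTheory.Automorphic.ArthurClozelFibres
import Literature.NumberTheory.LFunctions.NumberFieldDirichletDensity

/-!
# Crux `SelfTwistedIrreducible` (stmt-Langlands-18055), line `Sketch`, stub `stub_pinnedDoublingKill`: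
# the Rankin–Selberg bound on the scalar places and the density contradiction

For a cuspidal automorphic representation `Π` of `GL₂(𝔸_F)` in `L²_cusp` with Satake family `α` off
a finite `S`:

* `eventually_log_le_tsum_rpow_neg` — `(3/4) log (1/(σ-1)) ≤ Σ_{v ∉ S} q_v^{-σ}` for `σ → 1⁺`
  (all primes have Dirichlet density `1`, the tree's `hasStrongDirichletDensity_univ`);
* `exists_eventually_tsum_normSq_sum_le` — **Rankin–Selberg**:
  `Σ_{w ∉ S} |tr α(w)|² q_w^{-σ} ≤ log (1/(σ-1)) + C` for `σ → 1⁺`: the left side is the `k = 1`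
  part of the non-negative series (5.3.3) of Jacquet–Shalika whose exponential is
  `L^S(σ, Π × Π̄)` (`partialPairL_conjFamily_eq_exp_LSeries_of_summable`, inputs
  `norm_satakeParameter_le_sqrt_holds`, `summable_normSq_trace_satakePow_holds`), and
  `(σ - 1) L^S(σ, Π × Π̄)` has a finite limit (Arthur–Clozel (2.3) in rank `2`, PROVED:
  `JacquetShalika1981_partialPairL_pole_of_eq_conj_holds_of_le_two`);
* `eq_one_of_scalar_at_ne_one` (**main**) — if a unitary Hecke character `ν`, unramified off `S`,
  satisfies `ν(ϖ_w) ≠ 1 ⇒ α(w)` scalar (`{a, a}`) for `w ∉ S`, then `ν = 1`.  Otherwise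
  `q_w^{-σ} ≤ Re ν(ϖ_w) q_w^{-σ} + ½ |tr α(w)|² q_w^{-σ}` termwise (`|a| = 1` at scalar places, as
  `|det α(w)| = 1`), and summing: `(3/4) ℓ ≤ C₂ + (ℓ + C₃)/2`, `ℓ = log (1/(σ-1)) → ∞` — the Hecke
  bound `exists_eventually_re_tsum_heckeCharacter_le` against the Rankin–Selberg bound.
-/

noncomputable section

set_option linter.dupNamespace false -- `Summit.Langlands.Langlands` is the mandated namespace

namespace Summit.Langlands.Langlands.Cruxes.SelfTwistedIrreducible.DetPinning

open scoped NumberField Topology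
open Filter NumberField IsDedekindDomain MeasureTheory
open Literature.NumberTheory.GaloisRepresentations Literature.NumberTheory.Automorphic
open Literature.NumberTheory.LFunctions

variable {F : Type} [Field F] [NumberField F]

/-! ### Elementary -/

/-- `Re ((q_v : ℂ) ^ (-σ)) = q_v ^ (-σ)` for real `σ`. [folklore] -/
theorem re_residueCard_cpow_neg (v : HeightOneSpectrum (𝓞 F)) (σ : ℝ) :
    ((v.residueCard : ℂ) ^ (-(σ : ℂ))).re = (v.residueCard : ℝ) ^ (-σ) := by
  rw [show ((v.residueCard : ℂ)) = ((v.residueCard : ℝ) : ℂ) by push_cast; rfl,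
    ← Complex.ofReal_neg, ← Complex.ofReal_cpow (residueCard_pos_real v).le, Complex.ofReal_re]

/-- `q_v^{-σ} ≤ 1` for `σ ≥ 0`. [folklore] -/
theorem residueCard_rpow_neg_le_one (v : HeightOneSpectrum (𝓞 F)) {σ : ℝ} (hσ : 0 ≤ σ) :
    (v.residueCard : ℝ) ^ (-σ) ≤ 1 :=
  Real.rpow_le_one_of_one_le_of_nonpos (by exact_mod_cast v.one_lt_residueCard.le) (by linarith)

/-! ### All primes: `Σ_{v ∉ S} q_v^{-σ} ≥ (3/4) log (1/(σ-1))` -/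

/-- **All primes off a finite set carry density one**: for `S` finite,
`(3/4) log (1/(σ-1)) ≤ Σ_{v ∉ S} q_v^{-σ}` for all `σ → 1⁺` (`Σ_v q_v^{-σ} ∼ log (1/(σ-1))`,
Neukirch VII (13.1)–(13.2), the tree's `hasStrongDirichletDensity_univ`; the finitely many `v ∈ S`
contribute at most `#S`). [cite: NeukirchANT1999, Ch. VII (13.2)] -/
theorem eventually_log_le_tsum_rpow_neg {S : Set (HeightOneSpectrum (𝓞 F))} (hS : S.Finite) :
    ∀ᶠ σ : ℝ in 𝓝[>] 1, 3 / 4 * Real.log (1 / (σ - 1)) ≤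
      ∑' v : {v // v ∉ S}, (v.1.residueCard : ℝ) ^ (-σ) := by
  haveI : Fintype S := hS.fintype
  have hlim := Literature.NumberTheory.LFunctions.NumberField.tendsto_tsum_indicator_absNorm_div_log
    (hasStrongDirichletDensity_univ F)
  have hℓ := PrimeSum.tendsto_log_one_div_sub_one
  filter_upwards [hlim.eventually (lt_mem_nhds (by norm_num : (7 / 8 : ℝ) < 1)),
    PrimeSum.eventually_log_pos, hℓ.eventually_ge_atTop (8 * (Fintype.card S : ℝ)),
    self_mem_nhdsWithin] with σ h78 hlog hcard hσ1
  have hσ : 1 < σ := hσ1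
  set ℓ := Real.log (1 / (σ - 1)) with hℓdef
  set f : HeightOneSpectrum (𝓞 F) → ℝ := fun v => (v.residueCard : ℝ) ^ (-σ) with hfdef
  have hf : Summable f := Literature.NumberTheory.LFunctions.summable_absNorm_rpow_neg hσ
  -- the full sum is `> (7/8) ℓ`
  have hfull : 7 / 8 * ℓ < ∑' v, f v := by
    simp only [Set.mem_univ, if_true] at h78
    exact (lt_div_iff₀ hlog).mp h78
  -- the sum over `S` is at most `#S ≤ ℓ / 8`
  have hSle : ∑' v : S, f v ≤ ℓ / 8 := by
    rw [tsum_fintype]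
    calc ∑ v : S, f v ≤ ∑ _v : S, (1 : ℝ) :=
          Finset.sum_le_sum fun v _ => residueCard_rpow_neg_le_one v.1 (by linarith)
      _ = Fintype.card S := by simp
      _ ≤ ℓ / 8 := by linarith
  have hsplit := hf.tsum_subtype_add_tsum_subtype_compl S
  have hcompl : ∑' v : {v // v ∉ S}, (v.1.residueCard : ℝ) ^ (-σ) = ∑' v : ↥Sᶜ, f v := rfl
  rw [hcompl]
  linarith

/-! ### Rankin–Selberg: the `|tr|²`-weighted prime sum is at most `log (1/(σ-1)) + C` -/

section RankinSelberg

variable {μ : Measure (AdelicGroupData.gl 2 F).automorphicQuotient}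
  [(AdelicGroupData.gl 2 F).IsAutomorphicMeasure μ]

/-- **Rankin–Selberg bound on `Σ |tr α(w)|² q_w^{-σ}`.** For a cuspidal automorphic
representation `Π` of `GL₂(𝔸_F)` (in `L²_cusp`) with Satake family `α` off the finite `S`, the series
`Σ_{w ∉ S} |tr α(w)|² q_w^{-σ}` converges for `σ > 1` and is `≤ log (1/(σ-1)) + C` for all
`σ → 1⁺`: it is the `k = 1` part of Jacquet–Shalika's non-negative series (5.3.3)
`f(σ) = Σ_{w,k} |tr α(w)^k|² q_w^{-kσ}/k` (`summable_normSq_trace_satakePow_holds`), and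
`L^S(σ, Π × Π̄) = exp f(σ)` (`partialPairL_conjFamily_eq_exp_LSeries_of_summable`) with
`(σ - 1) L^S(σ, Π × Π̄) → c` (Arthur–Clozel (2.3) in rank two,
`JacquetShalika1981_partialPairL_pole_of_eq_conj_holds_of_le_two`), so `f(σ) ≤ log (1/(σ-1)) + C`.
[cite: JacquetShalikaAJM1981, Thm. (5.3), proof, (5.3.3) p. 556]
[cite: ArthurClozelAMS120, Ch. 3 §2, (2.3), p. 171] -/
theorem exists_eventually_tsum_normSq_sum_le (P : CuspidalAutomorphicRepGL 2 F μ)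
    {S : Set (HeightOneSpectrum (𝓞 F))} (hS : S.Finite) {α : SatakeFamily F}
    (hα : IsSatakeFamilyOf P S α) :
    (∀ σ : ℝ, 1 < σ →
      Summable fun w : {v // v ∉ S} => ‖(α w.1).sum‖ ^ 2 * (w.1.residueCard : ℝ) ^ (-σ)) ∧
    ∃ C : ℝ, ∀ᶠ σ : ℝ in 𝓝[>] 1,
      ∑' w : {v // v ∉ S}, ‖(α w.1).sum‖ ^ 2 * (w.1.residueCard : ℝ) ^ (-σ) ≤
        Real.log (1 / (σ - 1)) + C := by
  set T := {v : HeightOneSpectrum (𝓞 F) // v ∉ S}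
  -- (5.1.3) and (5.3.3)
  have hb : ∀ v ∉ S, ∀ a ∈ α v, ‖a‖ ≤ Real.sqrt v.residueCard := fun v hv a ha =>
    norm_satakeParameter_le_sqrt_holds P hα hv ha
  have hsum : ∀ σ : ℝ, 1 < σ →
      Summable fun i : ℕ × T => jsCoeff S α i * (jsBase S i : ℝ) ^ (-σ) := fun σ hσ =>
    (summable_normSq_trace_satakePow_holds P hα hσ).congr fun i => (jsCoeff_mul_rpow_neg S α σ i).symm
  -- the `k = 1` terms
  set e : T → ℕ × T := fun w => (0, w) with hedef
  have he : Function.Injective e := fun a b h => (Prod.ext_iff.mp h).2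
  have hterm : ∀ (σ : ℝ) (w : T), jsCoeff S α (e w) * (jsBase S (e w) : ℝ) ^ (-σ) =
      ‖(α w.1).sum‖ ^ 2 * (w.1.residueCard : ℝ) ^ (-σ) := by
    intro σ w
    simp [hedef, jsCoeff, jsBase]
  have hsum0 : ∀ σ : ℝ, 1 < σ →
      Summable fun w : T => ‖(α w.1).sum‖ ^ 2 * (w.1.residueCard : ℝ) ^ (-σ) := fun σ hσ =>
    ((hsum σ hσ).comp_injective he).congr fun w => hterm σ w
  refine ⟨hsum0, ?_⟩
  -- `L^S(σ, α ⊗ ᾱ) = exp (R σ)`, `R σ = Σ_i jsCoeff_i jsBase_i^{-σ}`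
  have hL : ∀ σ : ℝ, 1 < σ → partialPairL S α (fun v => (α v).map (starRingEnd ℂ)) σ =
      Complex.exp ((∑' i : ℕ × T, jsCoeff S α i * (jsBase S i : ℝ) ^ (-σ) : ℝ) : ℂ) := by
    intro σ hσ
    have hs : 1 < (σ : ℂ).re := by simpa using hσ
    have hsum' : Summable fun i : ℕ × T => jsCoeff S α i * (jsBase S i : ℝ) ^ (-(σ : ℂ).re) := by
      simpa using hsum σ hσ
    have h := partialPairL_conjFamily_eq_exp_LSeries_of_summable hb hs hsum'
    rw [show conjFamily α = fun v => (α v).map (starRingEnd ℂ) from rfl] at h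
    rw [h]
    congr 1
    have hsumC := summable_ofReal_mul_natCast_cpow (jsCoeff_nonneg S α) (jsBase_ne_zero S) hsum'
    rw [normSqTraceSeries, LSeries_fiberCoeff_eq (jsBase_ne_zero S) hsumC, Complex.ofReal_tsum]
    refine tsum_congr fun i => ?_
    rw [Complex.ofReal_mul, Complex.ofReal_cpow (Nat.cast_nonneg _), Complex.ofReal_natCast,
      Complex.ofReal_neg]
  -- the simple pole (2.3), rank two
  obtain ⟨c, -, hc⟩ := JacquetShalika1981_partialPairL_pole_of_eq_conj_holds_of_le_two (μ := μ)
    le_rfl two_pos P P.conj (CuspidalAutomorphicRepGL.conj_conj P).symm hS hα hα.conj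
  have hcℝ := hc.comp tendsto_ofReal_nhdsWithin_one
  refine ⟨Real.log (‖c‖ + 1), ?_⟩
  filter_upwards [hcℝ.norm.eventually_lt_const (lt_add_one ‖c‖), self_mem_nhdsWithin]
    with σ hlt hσ1
  have hσ : 1 < σ := hσ1
  set R : ℝ := ∑' i : ℕ × T, jsCoeff S α i * (jsBase S i : ℝ) ^ (-σ) with hRdef
  -- `(σ - 1) exp (R σ) < ‖c‖ + 1`
  have hval : ‖((σ : ℂ) - 1) * partialPairL S α (fun v => (α v).map (starRingEnd ℂ)) σ‖ =
      (σ - 1) * Real.exp R := by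
    rw [norm_mul, hL σ hσ, Complex.norm_exp, Complex.ofReal_re, ← Complex.ofReal_one,
      ← Complex.ofReal_sub, Complex.norm_real, Real.norm_of_nonneg (by linarith)]
  simp only [Function.comp_apply] at hlt
  rw [hval] at hlt
  have hpos : 0 < (σ - 1) * Real.exp R := mul_pos (by linarith) (Real.exp_pos _)
  have hlog := Real.log_lt_log hpos hlt
  rw [Real.log_mul (by linarith) (Real.exp_pos _).ne', Real.log_exp] at hlog
  have hℓ : Real.log (1 / (σ - 1)) = -Real.log (σ - 1) := by rw [one_div, Real.log_inv]
  -- the `k = 1` subseries is at most `R`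
  have hsub : ∑' w : T, ‖(α w.1).sum‖ ^ 2 * (w.1.residueCard : ℝ) ^ (-σ) ≤ R :=
    Summable.tsum_le_tsum_of_inj e he
      (fun i _ => mul_nonneg (jsCoeff_nonneg S α i) (Real.rpow_nonneg (Nat.cast_nonneg _) _))
      (fun w => (hterm σ w).symm.le) (hsum0 σ hσ) (hsum σ hσ)
  linarith

/-! ### The density contradiction -/

/-- **A unitary Hecke character which is non-trivial only at scalar places is trivial.** Let `Π` be
a cuspidal automorphic representation of `GL₂(𝔸_F)` with Satake family `α` off the finite `S`, and
`ν` a unitary Hecke character unramified off `S` such that, for every `w ∉ S`, `ν(ϖ_w) ≠ 1` forces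
`α(w) = {a, a}` to be scalar. Then `ν = 1`. Proof: if `ν ≠ 1`, termwise for `w ∉ S`,
`q_w^{-σ} ≤ Re ν(ϖ_w) q_w^{-σ} + ½ |tr α(w)|² q_w^{-σ}` (at a scalar place `|a|² = |det α(w)| = 1`,
`HasSatakeParameterAt.norm_prod_eq_one`, so `|tr α(w)|² = 4`, while `Re ν(ϖ_w) ≥ -1`); summing over
`w ∉ S` and letting `σ → 1⁺`: `(3/4) log (1/(σ-1)) ≤ C₂ + (log (1/(σ-1)) + C₃)/2`
(`eventually_log_le_tsum_rpow_neg`, `exists_eventually_re_tsum_heckeCharacter_le`,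
`exists_eventually_tsum_normSq_sum_le`), absurd. [folklore] -/
theorem eq_one_of_scalar_at_ne_one :
    ∀ {F : Type} [Field F] [NumberField F]
      {μ : MeasureTheory.Measure (AdelicGroupData.gl 2 F).automorphicQuotient}
      [(AdelicGroupData.gl 2 F).IsAutomorphicMeasure μ] (P : CuspidalAutomorphicRepGL 2 F μ)
      {S : Set (HeightOneSpectrum (𝓞 F))}, S.Finite → ∀ {α : SatakeFamily F}, IsSatakeFamilyOf P S α →
        ∀ {ν : HeckeCharacter F}, ν.IsUnitary → (∀ v ∉ S, ν.IsUnramifiedAt v) →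
          (∀ w ∉ S, ν.valueAtUniformizer w ≠ 1 → ∃ a : ℂ, α w = {a, a}) → ν = 1 := by
  intro F _ _ μ _ P S hS α hα ν hu hur h
  by_contra h1
  set T := {v : HeightOneSpectrum (𝓞 F) // v ∉ S}
  obtain ⟨C₂, hC₂⟩ := exists_eventually_re_tsum_heckeCharacter_le hu h1 hS hur
  obtain ⟨hsumT, C₃, hC₃⟩ := exists_eventually_tsum_normSq_sum_le P hS hα
  have hP := eventually_log_le_tsum_rpow_neg (F := F) hS
  have hℓ := PrimeSum.tendsto_log_one_div_sub_one.eventually_ge_atTop (4 * (C₂ + C₃ / 2) + 1)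
  obtain ⟨σ, hσ1, h2, h3, h4, h5⟩ :=
    (PrimeSum.eventually_one_lt.and (hC₂.and (hC₃.and (hP.and hℓ)))).exists
  have hσ : 1 < σ := hσ1
  have hcv : ∀ v : HeightOneSpectrum (𝓞 F), ‖ν.valueAtUniformizer v‖ ≤ 1 := fun v =>
    (HeckeCharacter.norm_valueAtUniformizer_of_isUnitary hu v).le
  -- termwise inequality
  have hpt : ∀ w : T, (w.1.residueCard : ℝ) ^ (-σ) ≤
      (ν.valueAtUniformizer w.1 * (w.1.residueCard : ℂ) ^ (-(σ : ℂ))).re +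
        1 / 2 * (‖(α w.1).sum‖ ^ 2 * (w.1.residueCard : ℝ) ^ (-σ)) := by
    intro w
    have hq0 : 0 ≤ (w.1.residueCard : ℝ) ^ (-σ) := Real.rpow_nonneg (Nat.cast_nonneg _) _
    by_cases hne : ν.valueAtUniformizer w.1 = 1
    · rw [hne, one_mul, re_residueCard_cpow_neg]
      nlinarith [sq_nonneg ‖(α w.1).sum‖]
    · obtain ⟨a, ha⟩ := h w.1 w.2 hne
      obtain ⟨𝔫, -, -, ϖ, hSat⟩ := hα w.1 w.2
      have hprod := hSat.norm_prod_eq_one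
      rw [ha, Multiset.insert_eq_cons, Multiset.prod_cons, Multiset.prod_singleton, norm_mul] at hprod
      have ha1 : ‖a‖ = 1 := by nlinarith [norm_nonneg a]
      have htr : ‖(α w.1).sum‖ ^ 2 = 4 := by
        rw [ha, Multiset.insert_eq_cons, Multiset.sum_cons, Multiset.sum_singleton, ← two_mul,
          norm_mul, ha1, Complex.norm_two]
        norm_num
      have hre : -((w.1.residueCard : ℝ) ^ (-σ)) ≤
          (ν.valueAtUniformizer w.1 * (w.1.residueCard : ℂ) ^ (-(σ : ℂ))).re := by
        have hn := norm_mul_residueCard_cpow_le w.1 (hcv w.1) σ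
        exact (abs_le.mp ((Complex.abs_re_le_norm _).trans hn)).1
      rw [htr]
      linarith
  -- sum over `w ∉ S`
  have hsq : Summable fun w : T => (w.1.residueCard : ℝ) ^ (-σ) :=
    summable_residueCard_rpow_neg_subtype _ hσ
  have hsν : Summable fun w : T => ν.valueAtUniformizer w.1 * (w.1.residueCard : ℂ) ^ (-(σ : ℂ)) :=
    Summable.of_norm (hsq.of_nonneg_of_le (fun _ => norm_nonneg _) fun w =>
      norm_mul_residueCard_cpow_le w.1 (hcv w.1) σ)
  have hsre : Summable fun w : T =>
      (ν.valueAtUniformizer w.1 * (w.1.residueCard : ℂ) ^ (-(σ : ℂ))).re :=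
    (Complex.hasSum_re hsν.hasSum).summable
  have hsT := hsumT σ hσ
  have hle := Summable.tsum_le_tsum hpt hsq (hsre.add (hsT.mul_left (1 / 2)))
  rw [hsre.tsum_add (hsT.mul_left _), tsum_mul_left, ← Complex.re_tsum hsν] at hle
  linarith

end RankinSelberg

end Summit.Langlands.Langlands.Cruxes.SelfTwistedIrreducible.DetPinning

end
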